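import Literature.MathematicalPhysics.QuantumFieldTheory.Balaban1983to89.B9Eq326OperatorTowerReality
import Literature.MathematicalPhysics.QuantumFieldTheory.Balaban1983to89.B7Eq43AveragedSmallnessLevelFree

/-!
# `Balaban1983to89.B9Eq326OperatorTowerRealityUnitary` — T. Bałaban, *Propagators for lattice gauge theories in a background field*, Commun. Math.
# Phys. **99** (1985) 389–434 [Balaban1985BackgroundPropagators] (3.15) p. 393, (3.19)/(3.21) p. 394, (3.24) p. 394, with *Averaging operations for
# lattice gauge theories*, Commun. Math. Phys. **98** (1985) 17–51 [Balaban1985Averaging] Prop. 2 (52)–(54) p. 26: **THE UNITARITY LETTER `hUlev` OF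
# `B9Eq326OperatorTowerReality` DISCHARGED — for a background with values in the unitary group of a C⋆-algebra inside Prop. 2's window, every LEVEL
# background `Ū^j` is unitary, hence `Q′_k(U)`, `R_k(U)`, `Δ′_{a′,k}(U)`, `G′_k(U)` commute with `⋆` with NO unitarity hypothesis on the levels left**

statement-level skeleton of published theorems with citation tags; proofs where landed; nothing here is a claim about the Yang–Mills mass gap

CITATION HEADER (lean-in-tree rule).  Audit cell `pub-balaban`, sub-cell `t4`, BINDER row NE9; filed by NE9 formalisation-swarm LEAF PROVER 05
(`b2b-balaban-t4-ne9-formalise-leaf-05`, gen 75), step (vi) «k-level reality» of the row OWNER's Δ_π port (DIAGNOSIS D-ne9p1-g87-1), third file: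
`B9Eq326OperatorTowerReality` (this lineage, gen 75) proved the reality of the k-th-step letters under the DISPLAYED letter
`hUlev : ∀ j b, (Ū^j(b))⋆ = (Ū^j(b))⁻¹`; this file inhabits that letter from print's data.  Sources READ: [Balaban1985Averaging] p. 23 *«Let U be a
gauge field configuration with values in U(N)»*, Prop. 2 p. 26 (52)–(54) (the iterated averages stay in the small-field class — and, tacitly in print,
in the GROUP: the cell's `B7Prop2Explicit.avgClosed_unitaryUnits`, (22)–(23) p. 21: the logarithm of a unitary near `1` is skew-adjoint, so the
average (42) is unitary); [Balaban1985BackgroundPropagators] (3.15) p. 393 (the level backgrounds `U^{(j)}` of the composite averaging).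

WHAT IS PROVED (sorry-free; proof lane — no `def`; [folklore] plumbing BY NAME: `B7Eq43AveragedSmallnessLevelFree.UlevOf_mem` at the `AvgClosed`
subgroup `unitaryUnits 𝔸` + `star u = u⁻¹` on it).
* §1 `star_val_eq_inv_of_mem_unitaryUnits` (`u ∈ unitaryUnits 𝔸 ⇒ u⋆ = u⁻¹`, any star-monoid), `forall_star_eq_inv_of_mem` (bond fields).
* §2 **`UlevOf_star_eq_inv`** — `𝔸` a non-trivial C⋆-algebra, `L ≥ 2`, `U(b) ∈ unitaryUnits 𝔸`, Prop. 2's numeric window `0 < α₀`, `C₀α₀ ≤ 1∕3`,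
  `2α₀ ≤ c₂′`, and the plaquette smallness `pdev Ũ < α₀L^{−2(n+1)}` of the periodic extension: `(Ū^j(b))⋆ = (Ū^j(b))⁻¹` for EVERY level `j` and bond
  `b` — the letter `hUlev` of `B9Eq326OperatorTowerReality`; **`UlevOf_star_eq_inv_of_plaq`** — the same from the TORUS plaquette window
  `‖U(∂p) − 1‖ ≤ αη²` on print's diagonal `ηL^{n+1} = 1` with `α < α₀` (`pdev_perCfg_le_of_plaq`).
* §3 CONSUMPTION PATTERN (four `example`s, no new names — the identities themselves are `B9Eq326OperatorTowerReality`'s, by the cell's dedup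
  rule not restated as theorems): `Q′_k(U)`, `R_k(U)`, `Δ′_{a′,k}(U)`, `G′_k(U)` commute with `⋆` for a `unitaryUnits`-valued tower in Prop. 2's window
  with `hUlev` AND `hU` discharged by §1–§2 (the trace letters `hφ hτ₁ hτ₂` stay displayed — they concern the Hilbert structure `φ : W ≃ 𝔸`, not the
  background).
HONEST SCOPE.  Plumbing by name; no estimate of the paper; the numeric window is Prop. 2's as typed in `B7Prop2Explicit` (constants `C0 d`, `c2' d L`);
ONE letter of ONE sub-step ((vi) of the Δ_π port) inhabited — NOT NE9 (cell pub-balaban: NE9 NOT PRINTED ∕ NOT PROVED; «NE9 ⇐ the named binders»;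
row WALLED ON A MODEL (O-NE9-1; #5 UNRULED); spine PROVED 0∕9; rung (B)+1 on a finite T⁴ — NOT infinite volume, NOT mass gap, NOT BetaPertH, NOT Clay;
HONEST DEPENDENCY: continuum YM on T⁴ ⇐ BetaPertH ∧ nine spine estimates (0/9 proved); BetaPertH ⇐ (D1) ∧ (D4) ∧ CAP+tail; G-an2-4 gates asym, D1
and NE2/3/4).  NEW file; imports `B9Eq326OperatorTowerReality` + `B7Eq43AveragedSmallnessLevelFree`; nothing modified.  Net new unproved facts: 0.
-/

noncomputable section

open scoped InnerProductSpace ComplexConjugate BigOperators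

namespace Literature.MathematicalPhysics.QuantumFieldTheory.Balaban1983to89.B9Eq326OperatorTowerRealityUnitary

open B4Sect5Torus (TSite)
open B9SectCLatticeCarrier (Bond)
open B9Eq311TracePairing (starW)
open B11Eq103H1Complex (SiteL2K)
open B9Eq315QTorus (perCfg)
open B9Eq315QTower (towerP UlevOf)
open B9Eq326OperatorTower (QprimeTowerW RofUk)
open B9Eq324DeltaPrimeATower (laplacePrimeAk GpOfUk)
open B9Eq310DeltaPrime (plaqHolU)
open B7Prop1Explicit (U1)
open B7Prop2Explicit (pdev C0 c2' unitaryUnits mem_unitaryUnits avgClosed_unitaryUnits unitaryUnits_le_U1)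
open B7Eq43AveragedSmallnessLevelFree (UlevOf_mem pdev_perCfg_le_of_plaq)
open B9Eq326OperatorTowerReality (QprimeTowerW_starW RofUk_starW laplacePrimeAk_starW GpOfUk_starW)

/-! ## §1 `u⋆ = u⁻¹` on the unitary units -/

section Star

variable {𝔸 : Type*} [Monoid 𝔸] [StarMul 𝔸]

/-- On the unitary units of a star-monoid, `star` is the group inverse: `u ∈ unitaryUnits 𝔸 ⇒ (u : 𝔸)⋆ = ((u⁻¹ : 𝔸ˣ) : 𝔸)`. [folklore]
[cite: Balaban1985Averaging, p.18, p.23 «values in U(N)»] -/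
theorem star_val_eq_inv_of_mem_unitaryUnits {u : 𝔸ˣ} (hu : u ∈ unitaryUnits 𝔸) : star (u : 𝔸) = ((u⁻¹ : 𝔸ˣ) : 𝔸) := by
  rw [mem_unitaryUnits] at hu
  calc star (u : 𝔸) = ((u⁻¹ : 𝔸ˣ) : 𝔸) * ((u : 𝔸) * star (u : 𝔸)) := by rw [← mul_assoc, Units.inv_mul, one_mul]
    _ = ((u⁻¹ : 𝔸ˣ) : 𝔸) := by rw [Unitary.mul_star_self_of_mem hu, mul_one]

/-- Bond-field form of §1: a `unitaryUnits`-valued background satisfies the letter `hU` of `B9Eq326OperatorTowerReality`. [folklore]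
[cite: Balaban1985Averaging, p.23] -/
theorem forall_star_eq_inv_of_mem {ι : Type*} {U : ι → 𝔸ˣ} (hU : ∀ b, U b ∈ unitaryUnits 𝔸) (b : ι) :
    star (U b : 𝔸) = ((U b)⁻¹ : 𝔸ˣ) :=
  star_val_eq_inv_of_mem_unitaryUnits (hU b)

end Star

/-! ## §2 The level backgrounds of a unitary tower are unitary -/

section Levels

variable {d : ℕ} (L : ℕ) [NeZero L] (m : Fin d → ℕ) [∀ i, NeZero (m i)] (n : ℕ)
  {𝔸 : Type*} [CStarAlgebra 𝔸] [Nontrivial 𝔸] (hL : 2 ≤ L)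
  {U : Bond d (towerP L m (n + 1)) → 𝔸ˣ} (hU : ∀ b, U b ∈ unitaryUnits 𝔸)
  {α₀ : ℝ} (hα : 0 < α₀) (hα3 : C0 d * α₀ ≤ 1 / 3) (hα2 : 2 * α₀ ≤ c2' d L)

include hL hU hα hα3 hα2

/-- **`hUlev` INHABITED**: inside Prop. 2's window, every level background `Ū^j(b)` of a `unitaryUnits`-valued tower is unitary, so `(Ū^j(b))⋆ = (Ū^j(b))⁻¹`
(`UlevOf_mem` at the `AvgClosed` subgroup `unitaryUnits 𝔸`). [cite: Balaban1985Averaging, Prop. 2 (52)–(54) p.26, (42) p.23, (22)–(23) p.21;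
Balaban1985BackgroundPropagators, (3.15) p.393] -/
theorem UlevOf_star_eq_inv (h52 : pdev (perCfg (towerP L m (n + 1)) U) < α₀ * (((L : ℝ) ^ (n + 1))⁻¹) ^ 2)
    (j : ℕ) (b : Bond d (towerP L m (j + 1))) :
    star (UlevOf L m (n + 1) U j b : 𝔸) = ((UlevOf L m (n + 1) U j b)⁻¹ : 𝔸ˣ) :=
  star_val_eq_inv_of_mem_unitaryUnits (UlevOf_mem L m n hL (avgClosed_unitaryUnits d L) hU hα hα3 hα2 h52 j b)

/-- **`hUlev` FROM THE TORUS PLAQUETTE WINDOW on print's diagonal `ηL^{n+1} = 1`**: `‖U(∂p) − 1‖ ≤ αη²` with `0 ≤ α < α₀` gives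
`pdev Ũ ≤ αη² < α₀L^{−2(n+1)}`, hence §2. [cite: Balaban1985BackgroundPropagators, (3.35) p.396, (3.15) p.393; Balaban1985Averaging, Prop. 2 (52) p.26] -/
theorem UlevOf_star_eq_inv_of_plaq {η α : ℝ} (hηL : η * (L : ℝ) ^ (n + 1) = 1) (hα0 : 0 ≤ α) (hαlt : α < α₀)
    (hpl : ∀ p : B9SectCLatticeCarrier.Plaq d (towerP L m (n + 1)), ‖(plaqHolU U p : 𝔸) - 1‖ ≤ α * η ^ 2)
    (j : ℕ) (b : Bond d (towerP L m (j + 1))) :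
    star (UlevOf L m (n + 1) U j b : 𝔸) = ((UlevOf L m (n + 1) U j b)⁻¹ : 𝔸ˣ) := by
  have hU1 : ∀ b, U b ∈ U1 𝔸 := fun b => unitaryUnits_le_U1 (hU b)
  have hLpos : (0 : ℝ) < (L : ℝ) ^ (n + 1) := pow_pos (by exact_mod_cast (show 0 < L by omega)) _
  have hη : η = ((L : ℝ) ^ (n + 1))⁻¹ := by
    field_simp
    linarith [hηL]
  have hpd : pdev (perCfg (towerP L m (n + 1)) U) ≤ α * η ^ 2 :=
    pdev_perCfg_le_of_plaq (U := U) hU1 (mul_nonneg hα0 (sq_nonneg η)) hpl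
  have h52 : pdev (perCfg (towerP L m (n + 1)) U) < α₀ * (((L : ℝ) ^ (n + 1))⁻¹) ^ 2 := by
    rw [← hη]
    have hη2 : 0 < η ^ 2 := by rw [hη]; positivity
    exact hpd.trans_lt (mul_lt_mul_of_pos_right hαlt hη2)
  exact UlevOf_star_eq_inv L m n hL hU hα hα3 hα2 h52 j b

end Levels

/-! ## §3 Consumption pattern: the k-th-step letters are real with no unitarity hypothesis on the levels left (examples) -/

section Tower

variable {d : ℕ} (L : ℕ) [NeZero L] {𝔸 : Type*} [CStarAlgebra 𝔸] [Nontrivial 𝔸]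
  {W : Type*} [NormedAddCommGroup W] [InnerProductSpace ℂ W] (φ : W ≃ₗ[ℂ] 𝔸)
  (m : Fin d → ℕ) [∀ i, NeZero (m i)] (n : ℕ) {c₀ : ℝ} [Fact (0 < c₀)] (η : ℝ) (hL : 2 ≤ L)
  {U : Bond d (towerP L m (n + 1)) → 𝔸ˣ} (hU : ∀ b, U b ∈ unitaryUnits 𝔸)
  {α₀ : ℝ} (hα : 0 < α₀) (hα3 : C0 d * α₀ ≤ 1 / 3) (hα2 : 2 * α₀ ≤ c2' d L)
  (h52 : pdev (perCfg (towerP L m (n + 1)) U) < α₀ * (((L : ℝ) ^ (n + 1))⁻¹) ^ 2)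

include hL hU hα hα3 hα2 h52

omit [Fact (0 < c₀)] in
/-- `Q′_k(U)` is real for a unitary tower in Prop. 2's window — `B9Eq326OperatorTowerReality.QprimeTowerW_starW` with `hUlev` discharged by §2.
[cite: Balaban1985BackgroundPropagators, (3.19) p.393, (3.15) p.393; Balaban1985Averaging, Prop. 2 p.26] -/
example (f : SiteL2K ℂ d (towerP L m (n + 1)) c₀ W) (y : TSite d m) :
    QprimeTowerW L m n φ U (starW φ f) y = φ.symm (star (φ (QprimeTowerW L m n φ U f y))) :=
  QprimeTowerW_starW L φ m n (UlevOf_star_eq_inv L m n hL hU hα hα3 hα2 h52) f y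

variable [FiniteDimensional ℂ W] (τ : 𝔸 →ₗ[ℂ] ℂ)
  (hφ : ∀ X Y : 𝔸, ⟪φ.symm X, φ.symm Y⟫_ℂ = τ (star X * Y)) (hτ₁ : ∀ X : 𝔸, τ (star X) = conj (τ X)) (hτ₂ : ∀ X Y : 𝔸, τ (X * Y) = τ (Y * X))

include hφ hτ₁ hτ₂

/-- `R_k(U)` is real for a unitary tower in Prop. 2's window — `RofUk_starW` with `hUlev`, `hU` discharged. [cite: Balaban1985BackgroundPropagators, (3.21) p.394] -/
example (f : SiteL2K ℂ d (towerP L m (n + 1)) c₀ W) :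
    RofUk L m n φ η U (starW φ f) = starW φ (RofUk L m n φ η U f) :=
  RofUk_starW L φ m n η (UlevOf_star_eq_inv L m n hL hU hα hα3 hα2 h52) (forall_star_eq_inv_of_mem hU) τ hφ hτ₁ hτ₂ f

variable {c₁ : ℝ} [Fact (0 < c₁)] (a' : ℝ)

/-- `Δ′_{a′,k}(U)` is real for a unitary tower in Prop. 2's window — `laplacePrimeAk_starW` with `hUlev`, `hU` discharged.
[cite: Balaban1985BackgroundPropagators, (3.24) p.394] -/
example (f : SiteL2K ℂ d (towerP L m (n + 1)) c₀ W) :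
    laplacePrimeAk L m n φ η U a' (c₁ := c₁) (starW φ f) = starW φ (laplacePrimeAk L m n φ η U a' (c₁ := c₁) f) :=
  laplacePrimeAk_starW L φ m n η (UlevOf_star_eq_inv L m n hL hU hα hα3 hα2 h52) (forall_star_eq_inv_of_mem hU) τ hφ hτ₁ hτ₂ a' f

/-- `G′_k(U)` is real for a unitary tower in Prop. 2's window — `GpOfUk_starW` with `hUlev`, `hU` discharged (the positivity witness `hpos′` ANY).
[cite: Balaban1985BackgroundPropagators, (3.26) p.395, Thm 3.11 p.416] -/
example
    (hpos' : ∀ x : SiteL2K ℂ d (towerP L m (n + 1)) c₀ W, x ≠ 0 → 0 < RCLike.re ⟪x, laplacePrimeAk L m n φ η U a' (c₁ := c₁) x⟫_ℂ)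
    (f : SiteL2K ℂ d (towerP L m (n + 1)) c₀ W) :
    GpOfUk L m n φ η U a' hpos' (starW φ f) = starW φ (GpOfUk L m n φ η U a' hpos' f) :=
  GpOfUk_starW L φ m n η (UlevOf_star_eq_inv L m n hL hU hα hα3 hα2 h52) (forall_star_eq_inv_of_mem hU) τ hφ hτ₁ hτ₂ a' hpos' f

end Tower

end Literature.MathematicalPhysics.QuantumFieldTheory.Balaban1983to89.B9Eq326OperatorTowerRealityUnitary

end
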